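import Summits.NavierStokesRegularity.FluidComputer.RowSegmentSound
import Summits.NavierStokesRegularity.FluidComputer.RowSwitchEq
import HarnessLib

/-!
# `RowChainSwitch`: the row chain of record (k53d) ACROSS its equal-phase switch `973|974` — rows `657–986` (phases
# `c1`, both rotor regimes) as one certified piece (`pub-fluidc-bp3/R1-DESIGN.md` §8.8 (3), layer B′)

HONEST FRAMING (cell `pub-fluidc`, blueprint seat bp3, gen 21): low prior, high value-of-information
experiment on Tao's machine paradigm; NOT a claim that NS blows up. Bookkeeping only: `swEq_973` decides
the exact equal-phase switch check `RowSwitchEq.swEqOK` on rows `973|974` of the chain of record (the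
regime switch `n2cR → slavedP` of the rotor pair: same lock coordinate `c1`, two frame rows re-selected),
and `segBC` chains `RowChain.segB` (rows 657–973) → `row_end` + `switchEq_hu0` at the switch →
`RowChain.segC` (rows 974–986): a member satisfying each row's `MemberOn` hypotheses on rows 657–986
whose frame coordinates start in row 657's box stays on every one of these 330 rows in that row's boxes.
The two STAGE switches `656|657` and `986|987` (new lock coordinate) remain.

[cite: Tao2016AveragedNS, §5.5 Thm 5.3 (5.5)]
-/

namespace Summit.NavierStokesRegularity.FluidComputer

open Literature.Analysis.FluidPDE.FluidComputer

namespace RowChain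

open RowCheck RowCheck.RowData RowRun Set

set_option maxHeartbeats 10000000 in
/-- **The equal-phase switch `973|974` of the chain of record passes the exact check.** [folklore] -/
theorem swEq_973 : swEqOK (row 973) (row 974) = true := by
  native_decide

/-- Row starts increase. [folklore] -/
theorem T_lt (k0 : ℕ) (T : ℕ → ℝ) (hT : ∀ k, T (k + 1) = T k + (row (k0 + k)).Hq) (k : ℕ) :
    T k < T (k + 1) := by
  rw [hT k]
  exact lt_add_of_pos_right _ (Hq_pos ((runOK_iff _).mp (runOK_row (k0 + k))).1)

/-- **Rows 657–986 as one piece** (segment B, the equal-phase switch `973|974`, segment C): see the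
module docstring. [folklore] -/
theorem segBC (T : ℕ → ℝ) (hT : ∀ k, T (k + 1) = T k + (row (657 + k)).Hq) (m : MemberData)
    (hmem : ∀ k < 330,
      (toModel (canon (framesOK_row (657 + k))) (G (657 + k)) (T k) m).MemberOn (T (k + 1)))
    (hu0 : ∀ i, |(toModel (canon (framesOK_row 657)) (G 657) (T 0) m).z (T 0) i| ≤ (row 657).ubR 0 i) :
    ∀ k < 330,
      (∀ i, |(toModel (canon (framesOK_row (657 + k))) (G (657 + k)) (T k) m).z (T k) i| ≤
        (row (657 + k)).ubR 0 i) ∧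
      (∀ t ∈ Icc (T k) (T (k + 1)), ∀ a,
        |(toModel (canon (framesOK_row (657 + k))) (G (657 + k)) (T k) m).e t a| ≤ (row (657 + k)).EbarR a) ∧
      (∀ t ∈ Icc (T k) (T (k + 1)), ∀ i,
        |(toModel (canon (framesOK_row (657 + k))) (G (657 + k)) (T k) m).z t i| ≤ (row (657 + k)).WbarR i) ∧
      (∀ t ∈ Ico (T k) (T (k + 1)), |m.sd t - 1| ≤ (row (657 + k)).rhoR) := by
  -- segment B: rows 657 … 973
  have hB := segB T hT m (fun k hk => hmem k (by omega)) hu0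
  -- the last row of segment B (973 = 657 + 316): its end box and its deviation box at the switch time
  have hrun : (row 973).runOK = true := runOK_row 973
  obtain ⟨hok, henc, -, hlk⟩ := (runOK_iff _).mp hrun
  have hTs : T (316 + 1) = T 316 + (row 973).Hq := hT 316
  have hBl := hB 316 (by norm_num)
  have hmemL : (toModel (canon (framesOK_row 973)) (G 973) (T 316) m).MemberOn (T 316 + (row 973).Hq) := by
    rw [← hTs]; exact hmem 316 (by norm_num)
  have hz : ∀ i, |(toModel (canon (framesOK_row 973)) (G 973) (T 316) m).z (T 316 + (row 973).Hq) i| ≤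
      (row 973).ubR (2 ^ (row 973).msub) i :=
    row_end (canon (framesOK_row 973)) (G 973) (T 316) m hok henc
      (canon_hrow (framesOK_row 973) hlk) hmemL hBl.1
  have he : ∀ a, |(toModel (canon (framesOK_row 973)) (G 973) (T 316) m).e (T 316 + (row 973).Hq) a| ≤
      (row 973).EbarR a := by
    intro a
    have h2 := hBl.2.1 (T (316 + 1)) ⟨(T_lt 657 T hT 316).le, le_rfl⟩ a
    rwa [hTs] at h2
  -- the switch: `hu0` of row 974 at T 317
  have hH : ((row 973).Hq : ℝ) ≠ 0 := (Hq_pos hok).ne'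
  have hu1 := switchEq_hu0 swEq_973 (framesOK_row 973) (framesOK_row 974) (G 973) (G 974) (T 316) m hH hz he
  -- segment C: rows 974 … 986, row starts `T (317 + k)`
  have hT' : ∀ k, T (317 + (k + 1)) = T (317 + k) + (row (974 + k)).Hq := by
    intro k
    have h := hT (317 + k)
    rw [show 657 + (317 + k) = 974 + k from by omega] at h
    exact h
  have hmem' : ∀ k < 13,
      (toModel (canon (framesOK_row (974 + k))) (G (974 + k)) (T (317 + k)) m).MemberOn (T (317 + (k + 1))) := by
    intro k hk
    have h := hmem (317 + k) (by omega)
    rw [show 657 + (317 + k) = 974 + k from by omega] at h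
    exact h
  have hu0' : ∀ i, |(toModel (canon (framesOK_row 974)) (G 974) (T (317 + 0)) m).z (T (317 + 0)) i| ≤
      (row 974).ubR 0 i := by
    rw [Nat.add_zero, hTs]; exact hu1
  have hC := segC (fun k => T (317 + k)) hT' m hmem' hu0'
  -- assemble
  intro k hk
  by_cases hkB : k < 317
  · exact hB k hkB
  · obtain ⟨j, rfl⟩ : ∃ j, k = 317 + j := ⟨k - 317, by omega⟩
    have hj : j < 13 := by omega
    rw [show 657 + (317 + j) = 974 + j from by omega]
    exact hC j hj

end RowChain

end Summit.NavierStokesRegularity.FluidComputer
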